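import Summits.QuantumFields.YangMills.Theorems.FiniteRankMirrorRungWitness

/-!
# BC5 rung (T3 witness) for `FiniteRankMirror.X₁ = FiniteRankMirrorFloor` — the S-restricted case,
# typed by name and DECIDED FALSE in the witness model

Tribunal-w seat `ym-mirror-bc5w-1` (g5, 2026-08-28), `--supports stmt-QuantumFields-25679` (route
`route-QuantumFields-FiniteRankMirror`; the same decl serves the sibling route
`route-QuantumFields-StaticSourceWitness`, item `stmt-QuantumFields-25284`, whose T3 witness lives in the
same model).

The kernel tribunal's T3 record (`t3k`) takes, besides the witness `C_rung` (here
`FiniteRankMirror.Rung.latticeMaxwell_finiteRankMirrorFloor`, resp.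
`StaticSourceWitness.Rung.latticeMaxwell_staticSourceResponse`), an `s_case := <decl>`: the summit leaf
S RESTRICTED TO THE WITNESS MODEL, stated as a `Prop`, which must NOT be provable there (the witness then
sits outside S's known regime).  Until now the family passed the witness by name but no S-case decl
existed, so both routes' kernel records carried the ambiguity `witness-regime-unverified`.

This file supplies that decl, as obligation nodes decided in-file (the tree's `@[conjecture] def … : Prop`
+ `@[refutes] theorem` pattern, cf. `HodgeLocusCensusTwoBlockRows`, `LacunarySymmetroidMatrixDescartesCensus…`).
The leaf both routes close is R2a = `BalabanLadder.NT` (`∃ r a, a > 0, a → 0, LowerBounds G r a`;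
`LowerBounds` = clause (i), a reflection-paired two-point floor of the smeared action density, AND clause
(ii), an `ε`-floor `ε ≤ |Q3(f,g,h)|` on its connected THREE-point function).  In the witness model — the
abelian lattice gauge theory of `ℤ⁴` at Gaussian coupling (`μM`, `densA`, `cfgReflA`) and its free Maxwell₄
continuum limit (covariance `maxwellKernel`) —
* `NTClauseIFreeAbelian` = clause (i)'s analogue, in the finite-rank shape of X₁'s block: TRUE
  (`ntClauseIFreeAbelian` = the banked `latticeMaxwell_finiteRankMirrorFloor`, `J = 1`, `p = 0`);
* `NTClauseIIFreeAbelian` = clause (ii)'s analogue (`∃ f g h ε, 0 < ε ≤ |8·maxwellRing3 f g h|`, `8·maxwellRing3`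
  being the Gaussian, Wick-square, connected three-point functional of `F_{μν}F_{μν}`): FALSE
  (`not_ntClauseIIFreeAbelian` = the banked `freeAbelian_NT_clauseII_false`; the odd ring
  `tr G(x−y)G(y−z)G(z−x)` vanishes pointwise, tree `maxwellRing3_eq_zero`);
* `NTFreeAbelian = NTClauseIFreeAbelian ∧ NTClauseIIFreeAbelian` = THE S-restricted case: FALSE
  (`not_ntFreeAbelian`) — the banked separation `latticeRung_separates`, with the S-case named
  (`ntClauseIFreeAbelian`, `not_ntFreeAbelian`).

Use (advisory kernel record, both routes): `harness/cli/tribunal check <route-id> --witness <C_rung> --s-case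
Summit.QuantumFields.YangMills.Theorems.FiniteRankMirror.Rung.NTFreeAbelian --residual <SkewAt…Unit>` (the
FiniteRankMirror probe imports this module by its file-name prefix; the StaticSourceWitness probe needs
`--imports Summits.QuantumFields.YangMills.Theorems.FiniteRankMirrorRungSCase`).  The S-case is not provable
(it is refuted by name), so `t3k.s_case.found = false` and the ambiguity `witness-regime-unverified` clears.

NOTHING HERE PROVES the Yang–Mills mass gap, `BalabanLadder.NT`, `FiniteRankMirrorFloor`,
`StaticSourceResponse` or any route item: it names the (false) S-restricted case of a T3 witness of
weakness, for the tribunal record only.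
-/

open MeasureTheory ProbabilityTheory Filter
open scoped Real NNReal ENNReal Topology

noncomputable section

namespace Summit.QuantumFields.YangMills.Theorems.FiniteRankMirror.Rung

open Literature.Probability.LatticeModels Literature.MathematicalPhysics.QuantumLattice
  Literature.MathematicalPhysics.QuantumFieldTheory
open Summit.QuantumFields.YangMills.Theorems.StaticSourceWitness.Rung (Cfg μM densA)
open scoped SchwartzMap
open Summit.QuantumFields.YangMills.Theorems.SelfNormalisedSkewness.Negative

/-- **S-restricted case, clause (i)** — NT's clause (i) (a reflection-paired two-point floor of the smeared
action density, uniform in the volume once `a·L ≥ Λ₅`, at arbitrarily small physical support `ℓ`) written in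
the witness model (abelian lattice gauge theory at Gaussian coupling: honest measure `μM`, density `densA`,
reflection `cfgReflA`, lattice spacing `a → 0` in place of `a β`, `β → ∞`), in the finite-rank shape of X₁'s
block.  It is literally the statement of the banked `latticeMaxwell_finiteRankMirrorFloor` (`J = 1`, `p = 0`),
hence TRUE (`ntClauseIFreeAbelian`). [this route] -/
@[conjecture] def NTClauseIFreeAbelian : Prop :=
  ∃ (J : ℕ) (p κ : ℝ), p < 8 ∧ 0 < κ ∧ ∀ ℓ₁ : ℝ, 0 < ℓ₁ →
    ∃ (ℓ : ℝ) (v : Fin J → SchwartzMap (EuclideanSpace ℝ (Fin 4)) ℝ) (a₀ Λ₅ : ℝ), 0 < ℓ ∧ ℓ < ℓ₁ ∧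
      (∀ j, tsupport (v j : EuclideanSpace ℝ (Fin 4) → ℝ) ⊆ {y | 0 < y 0} ∧
        tsupport (v j : EuclideanSpace ℝ (Fin 4) → ℝ) ⊆ Metric.closedBall 0 ℓ ∧ ∀ z, |v j z| ≤ 1) ∧
      0 < a₀ ∧ ∀ a : ℝ, 0 < a → a ≤ a₀ → ∀ L : ℕ, Λ₅ ≤ a * L →
        κ * ℓ ^ p ≤ ∑ j,
          ((∫ ω, (∑ y ∈ box 4 L, v j (a • siteToE y) * densA y (cfgReflA ω)) *
              ∑ y ∈ box 4 L, v j (a • siteToE y) * densA y ω ∂μM) -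
            (∫ ω, ∑ y ∈ box 4 L, v j (a • siteToE y) * densA y ω ∂μM) ^ 2)

/-- Clause (i)'s analogue HOLDS in the witness model — by name, the banked X₁ rung
`latticeMaxwell_finiteRankMirrorFloor` (file 2/3). [this route] -/
theorem ntClauseIFreeAbelian : NTClauseIFreeAbelian :=
  latticeMaxwell_finiteRankMirrorFloor

/-- **S-restricted case, clause (ii)** — NT's clause (ii) `ε`-floor on the connected THREE-point function of
the action density, written in the free abelian Maxwell₄ model (the continuum limit of the witness's lattice
model `μM`; covariance `maxwellKernel`), where the connected three-point functional of the smeared Wick squares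
`F²(f), F²(g), F²(h)` is `8·maxwellRing3 f g h`: SOME Schwartz triple and SOME `ε > 0` sit under it.  Decided
FALSE (`not_ntClauseIIFreeAbelian`); never a hypothesis of anything. [this route] -/
@[conjecture] def NTClauseIIFreeAbelian : Prop :=
  ∃ (f g h : 𝓢(E4, ℝ)) (ε : ℝ), 0 < ε ∧ ε ≤ |8 * maxwellRing3 f g h|

/-- Clause (ii)'s analogue is FALSE in the witness model: `8·maxwellRing3 ≡ 0` (`maxwellRing3_eq_zero`: the
odd ring `tr G(x−y)G(y−z)G(z−x)` of the free Maxwell covariance vanishes pointwise), so no `ε > 0` fits under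
it — by name, the banked `freeAbelian_NT_clauseII_false` (file 3/3). [this route] -/
@[refutes] theorem not_ntClauseIIFreeAbelian : ¬ NTClauseIIFreeAbelian :=
  freeAbelian_NT_clauseII_false

/-- **The S-restricted case** (the `s_case` of the T3 records of `stmt-QuantumFields-25679` and
`stmt-QuantumFields-25284`): the witness-model analogue of NT's `LowerBounds` = clause (i) ∧ clause (ii).
Decided FALSE (`not_ntFreeAbelian`) although its clause (i) conjunct is TRUE: the model decides C = X₁ TRUE
and S FALSE, so the witness sits outside S's regime. [this route] -/
@[conjecture] def NTFreeAbelian : Prop :=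
  NTClauseIFreeAbelian ∧ NTClauseIIFreeAbelian

/-- The S-restricted case is FALSE in the witness model (its clause (ii) conjunct is). [this route] -/
@[refutes] theorem not_ntFreeAbelian : ¬ NTFreeAbelian :=
  fun h => not_ntClauseIIFreeAbelian h.2

end Summit.QuantumFields.YangMills.Theorems.FiniteRankMirror.Rung

end
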